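import Literature.NumberTheory.Automorphic.RestrictedTensorProductLift
import Literature.RepresentationTheory.TwistedCoinvariants
import HarnessLib

/-!
# Product functionals on a restricted tensor product; twisted coinvariants of `⊗'_v π_v` are non-zero

Topic `NumberTheory/Automorphic`.  Kernel consequences of the tree's restricted-tensor-product API
(`RestrictedTensorProduct.lean`, `…ExistenceProofs.lean`, `…Lift.lean`: the characterising predicate
`IsRestrictedTensorProduct k j S₀` of a model `(W, j)` of `⊗'_i (V i, x₀ i)`, its universal map `lift`, the
retraction `x ↦ (∏_{i ∉ S} ℓ i (x i)) • ⊗_{i ∈ S} x i`, the representation `⊗'_i ρ i` of the restricted product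
`Πʳ i, [G i, K i]`, `IsRestrictedTensorProductRep`) and of the tree's twisted coinvariants
(`Literature/RepresentationTheory/TwistedCoinvariants.lean`: `TwistedCoinv.Coinv ρ χ = S ⧸ span {ρ h v − χ h • v}`, the
maximal quotient on which a group acts through a character; its universal property `TwistedCoinv.lift`).

## What is proved (Flath 1979, §2; Bump 1997, §3.3–3.4 — the «tensor product of local functionals»)

* `exists_prodDualFinset` — the linear form `⊗_{i ∈ S} x i ↦ ∏_{i ∈ S} ℓ i (x i)` on a finite tensor product.
* `IsRestrictedTensorProduct.exists_prodDual` — on ANY model `(W, j)` of the restricted tensor product, the PRODUCT `Λ`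
  of local linear forms `ℓ i : V i → k` normalised by `ℓ i (x₀ i) = 1` off the exceptional set `S₀`:
  `Λ (j x) = ∏_i ℓ i (x i)` (a finite product; `prodDual_apply_extend`); it is non-zero as soon as no `ℓ i`, `i ∈ S₀`,
  is zero (`prodDual_ne_zero`).
* `IsRestrictedTensorProductRep.prodDual_rep_apply` — EIGEN-PROPERTY: if `g = (g_i) ∈ Πʳ i, [G i, K i]` acts on each
  `ℓ i` by a scalar, `ℓ i ∘ ρ i (g i) = c i · ℓ i` (`c i = 1` for almost all `i`), then
  `Λ ∘ (⊗' ρ i)(g) = (∏_i c i) · Λ`.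
* `IsRestrictedTensorProductRep.nontrivial_coinv_of_localEigenfunctionals` — **LOCAL ⇒ GLOBAL NON-VANISHING OF TWISTED
  COINVARIANTS**: for a group `H` acting on `W` through `φ : H →* Πʳ i, [G i, K i]` and a character `χ : H →* kˣ`
  with `χ h = ∏_i c h i`, local `(φ h)_i`-eigenfunctionals `ℓ i` with eigenvalues `c h i`, normalised at the base
  vectors off `S₀` and non-zero on `S₀`, the `χ`-coinvariants `TwistedCoinv.Coinv (π ∘ φ) χ` of the restricted tensor
  product representation are a NON-ZERO space (the product functional is `χ`-equivariant and non-zero, hence descends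
  to a non-zero form on the coinvariants, `TwistedCoinv.lift`).  `…_of_localQuotients` — the same with the local input
  phrased through submodules `N i ≤ V i` containing every `ρ i ((φ h) i) v − c h i • v` (local «augmentations»): it
  suffices that `V i ⧸ N i ≠ 0` for `i ∈ S₀` and that the base vector `x₀ i` does NOT die in `V i ⧸ N i` for `i ∉ S₀`
  (over a field; private helpers supply the functionals).

## Why (the consumer)

[Liu2021, Def. 4.11] (FJcycle.tex l. 2092–2096) DEFINES the adèlic oscillator representation as the restricted tensor
product `ω(μ,ε,χ) := ⊗'_v ω(μ_v,ε_v,χ_v)` of the LOCAL maximal `χ_v`-quotients of App. D §D.1 Step 3, and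
App. D Lem. D.1 (1) gives `ω(μ_v,ε_v,χ_v) ≠ 0` at every finite place when `n ≥ 3`.  A model that instead presents the
global object as the `χ`-coinvariants of the GLOBAL finite-adèlic Weil representation `⊗'_v ω(μ_v, ε_v)` under the
centre `E¹(𝔸_F^∞)` (the Hodge/CM cell's genuine ω-carrier pin, `TwistedCoinv.Coinv (finPairRepW …) χ`) owes the
passage «local quotients non-zero ⇒ global coinvariants non-zero»; `nontrivial_coinv_of_localQuotients` is exactly
that passage, with the local non-vanishing (Lem. D.1 (1)) and the survival of the unramified vector («`ω(μ_v,ε_v,χ_v)` is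
unramified for all but finitely many `v`», Def. 4.11 l. 2092) as its two displayed local inputs.  No statement of this
file mentions Weil representations: everything is linear algebra of restricted tensor products.  Theorems only (the
product form is delivered as an existential with its defining property); no definition, no named fact, no instance,
no `sorry`.

## References

* D. Flath, *Decomposition of representations into tensor products*, Proc. Sympos. Pure Math. 33 (1979), part 1,
  179–183, §2 (restricted tensor products; linear forms `⊗ λ_v`). [Flath1979]
* D. Bump, *Automorphic Forms and Representations*, Cambridge Stud. Adv. Math. 55 (1997), §3.3–§3.4.
* Y. Liu, *Fourier–Jacobi cycles and arithmetic relative trace formula*, Camb. J. Math. 9 (2021) = arXiv:2102.11518,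
  Def. 4.11 (l. 2083–2097), App. D §D.1 and Lem. D.1 (l. 5209–5238) — context only. [Liu2021]
-/

noncomputable section

open scoped RestrictedProduct TensorProduct
open Filter PiTensorProduct Function

namespace Literature.NumberTheory.Automorphic

universe u uk uG uH v w

/-! ### Local suppliers: linear forms vanishing on a submodule (over a field) -/

section Dual

variable {k : Type uk} [Field k] {V : Type v} [AddCommGroup V] [Module k V]

/-- If `x ∉ N` there is a linear form killing `N` with value `1` at `x` (dual of the non-zero class of `x` in `V ⧸ N`).
[folklore] -/
private theorem exists_dual_vanishing_eq_one (N : Submodule k V) {x : V} (hx : x ∉ N) :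
    ∃ ℓ : V →ₗ[k] k, (∀ n ∈ N, ℓ n = 0) ∧ ℓ x = 1 := by
  have hq : N.mkQ x ≠ 0 := by
    rwa [Ne, Submodule.mkQ_apply, Submodule.Quotient.mk_eq_zero]
  obtain ⟨f, hf⟩ := Module.Projective.exists_dual_eq_one k hq
  refine ⟨f ∘ₗ N.mkQ, fun n hn => ?_, by simpa using hf⟩
  rw [LinearMap.comp_apply, Submodule.mkQ_apply, (Submodule.Quotient.mk_eq_zero N).2 hn, map_zero]

/-- A proper submodule is killed by some linear form taking the value `1` somewhere. [folklore] -/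
private theorem exists_dual_vanishing_of_ne_top (N : Submodule k V) (hN : N ≠ ⊤) :
    ∃ ℓ : V →ₗ[k] k, (∀ n ∈ N, ℓ n = 0) ∧ ∃ v : V, ℓ v = 1 := by
  obtain ⟨x, hx⟩ : ∃ x : V, x ∉ N := by
    by_contra h
    exact hN (eq_top_iff.2 fun x _ => not_not.1 fun hx => h ⟨x, hx⟩)
  obtain ⟨ℓ, hℓ, hx1⟩ := exists_dual_vanishing_eq_one N hx
  exact ⟨ℓ, hℓ, x, hx1⟩

end Dual

section Eigen

variable {k : Type uk} [CommRing k] {V : Type v} [AddCommGroup V] [Module k V]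

/-- A linear form killing every `A v − c • v` is an eigenform of `A` with eigenvalue `c`. [folklore] -/
private theorem apply_eq_mul_of_forall_sub_smul (ℓ : V →ₗ[k] k) (A : V →ₗ[k] V) (c : k)
    (h : ∀ v : V, ℓ (A v - c • v) = 0) (v : V) : ℓ (A v) = c * ℓ v := by
  have := h v
  rwa [map_sub, map_smul, smul_eq_mul, sub_eq_zero] at this

end Eigen

/-! ### The product of local linear forms on a finite tensor product -/

section Finite

variable {ι : Type u} {k : Type uk} [CommRing k] {V : ι → Type v} [∀ i, AddCommGroup (V i)]
  [∀ i, Module k (V i)]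

/-- The linear form `⊗_{i ∈ S} x i ↦ ∏_{i ∈ S} ℓ i (x i)` on the finite tensor product over a finset `S` exists (Mathlib
`PiTensorProduct.lift` of the product multilinear map `MultilinearMap.mkPiAlgebra` composed with the `ℓ i`).
(Flath 1979, §2.) [cite: Flath1979, §2] -/
theorem exists_prodDualFinset (ℓ : ∀ i, V i →ₗ[k] k) (S : Finset ι) :
    ∃ lamS : (⨂[k] i : S, V i) →ₗ[k] k, ∀ m : ∀ i : S, V i, lamS (tprod k m) = ∏ i : S, ℓ i (m i) :=
  ⟨PiTensorProduct.lift ((MultilinearMap.mkPiAlgebra k S k).compLinearMap fun i : S => ℓ i), fun m => by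
    simp [MultilinearMap.mkPiAlgebra_apply]⟩

end Finite

/-! ### The product of local linear forms on any model of the restricted tensor product -/

section ProdDual

variable {ι : Type u} {k : Type uk} [CommRing k] {V : ι → Type v} [∀ i, AddCommGroup (V i)]
  [∀ i, Module k (V i)] {x₀ : ∀ i, V i} {W : Type w} [AddCommGroup W] [Module k W] [DecidableEq ι]
  {j : RestrictedFamily V x₀ → W} {S₀ : Finset ι}

/-- A finite-product bookkeeping identity: splitting `∏ᶠ_i c i` along a finset `S`. [folklore] -/
private theorem finprod_eq_prod_mul_finprod_ite (c : ι → k) (hc : (mulSupport c).Finite) (S : Finset ι) :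
    ∏ᶠ i, c i = (∏ i ∈ S, c i) * ∏ᶠ i, (if i ∈ S then 1 else c i) := by
  classical
  have h1 : (mulSupport fun i => if i ∈ S then c i else 1) ⊆ ↑S := by
    intro i hi
    by_contra hiS
    exact hi (if_neg (fun h => hiS (Finset.mem_coe.2 h)))
  have h2 : (mulSupport fun i => if i ∈ S then (1 : k) else c i).Finite :=
    hc.subset fun i hi => by
      by_contra hci
      refine hi ?_
      show (if i ∈ S then (1 : k) else c i) = 1
      split_ifs
      · rfl
      · exact notMem_mulSupport.1 hci
  have hsplit : ∀ i, c i = (if i ∈ S then c i else 1) * (if i ∈ S then 1 else c i) := fun i => by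
    split_ifs <;> simp
  calc ∏ᶠ i, c i = ∏ᶠ i, (if i ∈ S then c i else 1) * (if i ∈ S then 1 else c i) := finprod_congr hsplit
    _ = (∏ᶠ i, if i ∈ S then c i else 1) * ∏ᶠ i, (if i ∈ S then 1 else c i) :=
        finprod_mul_distrib (hc.subset fun i hi => by
          by_contra hci
          refine hi ?_
          show (if i ∈ S then c i else 1) = 1
          split_ifs
          · exact notMem_mulSupport.1 hci
          · rfl) h2
    _ = (∏ i ∈ S, c i) * ∏ᶠ i, (if i ∈ S then 1 else c i) := by
        rw [finprod_eq_prod_of_mulSupport_subset _ h1]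
        congr 1
        exact Finset.prod_congr rfl fun i hi => if_pos hi

namespace IsRestrictedTensorProduct

/-- The factors of the retraction scalar have finite multiplicative support (they are `1` on `S₀` and wherever
`x i = x₀ i`). [folklore] -/
private theorem finite_mulSupport_retractionFactor (ℓ : ∀ i, V i →ₗ[k] k) (hℓ : ∀ i ∉ S₀, ℓ i (x₀ i) = 1)
    (x : RestrictedFamily V x₀) :
    (mulSupport (RestrictedTensorProduct.retractionFactor S₀ ℓ (⇑x))).Finite := by
  obtain ⟨T, -, hT⟩ := RestrictedFamily.exists_finset_forall_apply_eq (∅ : Finset ι) ({x} : Finset _)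
  exact (T.finite_toSet).subset
    (RestrictedTensorProduct.mulSupport_retractionFactor_subset hℓ x T (hT x (Finset.mem_singleton_self x)))

/-- **The product of local linear forms exists on every model** `(W, j)` of `⊗'_i (V i, x₀ i)`: for linear forms
`ℓ i : V i → k` with `ℓ i (x₀ i) = 1` off the exceptional set `S₀` there is a linear form `Λ : W → k` with
`Λ (j x) = ∏_i ℓ i (x i)` — written as the finite product `(∏_{i ∉ S₀} ℓ i (x i)) · ∏_{i ∈ S₀} ℓ i (x i)` (the first
factor is the tree's `retractionFactor` product) — namely the universal map (`lift`) of the tree's retraction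
`x ↦ (∏_{i ∉ S₀} ℓ i (x i)) • ⊗_{i ∈ S₀} x i` followed by the finite product form over `S₀`.  (Flath 1979, §2: the
forms `⊗_v λ_v`.) [cite: Flath1979, §2] -/
theorem exists_prodDual (h : IsRestrictedTensorProduct k j S₀) (ℓ : ∀ i, V i →ₗ[k] k)
    (hℓ : ∀ i ∉ S₀, ℓ i (x₀ i) = 1) :
    ∃ Λ : W →ₗ[k] k, ∀ x : RestrictedFamily V x₀,
      Λ (j x) = (∏ᶠ i, RestrictedTensorProduct.retractionFactor S₀ ℓ (⇑x) i) * ∏ i : S₀, ℓ i (x i) := by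
  obtain ⟨lamS, hlamS⟩ := exists_prodDualFinset ℓ S₀
  refine ⟨lamS ∘ₗ h.lift (RestrictedTensorProduct.isRestrictedMultilinear_retraction hℓ), fun x => ?_⟩
  simp only [LinearMap.comp_apply, lift_apply]
  rw [RestrictedTensorProduct.retraction, map_smul, hlamS, smul_eq_mul]
  rfl

/-- Value of such a product form on `j` of a finite family extended by base vectors: `∏_{i ∈ S₀} ℓ i (m i)` (the
normalisation `λ_v(ξ_v) = 1` off `S₀`, Flath 1979, §2). [cite: Flath1979, §2] -/
theorem prodDual_apply_extend {ℓ : ∀ i, V i →ₗ[k] k} (hℓ : ∀ i ∉ S₀, ℓ i (x₀ i) = 1) {Λ : W →ₗ[k] k}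
    (hΛ : ∀ x : RestrictedFamily V x₀,
      Λ (j x) = (∏ᶠ i, RestrictedTensorProduct.retractionFactor S₀ ℓ (⇑x) i) * ∏ i : S₀, ℓ i (x i))
    (m : ∀ i : S₀, V i) :
    Λ (j (RestrictedFamily.extend S₀ m)) = ∏ i : S₀, ℓ i (m i) := by
  rw [hΛ]
  have h1 : ∀ i, RestrictedTensorProduct.retractionFactor S₀ ℓ
      (⇑(RestrictedFamily.extend (x₀ := x₀) S₀ m)) i = 1 := by
    intro i
    simp only [RestrictedTensorProduct.retractionFactor]
    split_ifs with hi
    · rfl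
    · rw [RestrictedFamily.extend_apply_of_notMem _ _ hi, hℓ i hi]
  rw [finprod_eq_one_of_forall_eq_one h1, one_mul]
  exact Finset.prod_congr rfl fun i _ => by rw [RestrictedFamily.extend_apply_coe]

/-- Such a product form is non-zero as soon as each `ℓ i`, `i ∈ S₀`, takes the value `1` somewhere (e.g. `ℓ i ≠ 0` over a
field): its value at `j` of those vectors, extended by base vectors, is `1` (Flath 1979, §2). [cite: Flath1979, §2] -/
theorem prodDual_ne_zero [Nontrivial k] {ℓ : ∀ i, V i →ₗ[k] k} (hℓ : ∀ i ∉ S₀, ℓ i (x₀ i) = 1)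
    (hℓ1 : ∀ i ∈ S₀, ∃ v : V i, ℓ i v = 1) {Λ : W →ₗ[k] k}
    (hΛ : ∀ x : RestrictedFamily V x₀,
      Λ (j x) = (∏ᶠ i, RestrictedTensorProduct.retractionFactor S₀ ℓ (⇑x) i) * ∏ i : S₀, ℓ i (x i)) :
    Λ ≠ 0 := by
  choose m hm using fun i : S₀ => hℓ1 i i.2
  intro h0
  have h1 := prodDual_apply_extend hℓ hΛ m
  rw [h0, LinearMap.zero_apply, Finset.prod_congr rfl fun i _ => hm i, Finset.prod_const_one] at h1
  exact zero_ne_one h1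

end IsRestrictedTensorProduct

/-! ### Eigen-property under the restricted tensor product representation -/

variable {G : ι → Type uG} [∀ i, Group (G i)] {K : ∀ i, Subgroup (G i)}
  {ρ : ∀ i, Representation k (G i) (V i)} {hx₀ : ∀ᶠ i in cofinite, x₀ i ∈ (ρ i).fixedPoints (K i)}
  {π : Representation k (Πʳ i, [G i, K i]) W}

namespace IsRestrictedTensorProductRep

/-- **Eigen-property of the product form.**  If `g = (g_i)_i` acts on each local form by a scalar —
`ℓ i (ρ i (g i) v) = c i · ℓ i v` with `c i = 1` for almost all `i` — then a product form `Λ` (`exists_prodDual`) on the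
restricted tensor product representation satisfies `Λ ((⊗' ρ i)(g) w) = (∏_i c i) · Λ w`.  (On `j x` both sides are
finite products; the general case by linearity, the `j x` spanning `W`.) [cite: Flath1979, §2  Example 2] -/
theorem prodDual_rep_apply (hπ : IsRestrictedTensorProductRep ρ π hx₀ j S₀) {ℓ : ∀ i, V i →ₗ[k] k}
    (hℓ : ∀ i ∉ S₀, ℓ i (x₀ i) = 1) {Λ : W →ₗ[k] k}
    (hΛ : ∀ x : RestrictedFamily V x₀,
      Λ (j x) = (∏ᶠ i, RestrictedTensorProduct.retractionFactor S₀ ℓ (⇑x) i) * ∏ i : S₀, ℓ i (x i))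
    (g : Πʳ i, [G i, K i]) (c : ι → k)
    (hc : ∀ (i : ι) (v : V i), ℓ i (ρ i (g i) v) = c i * ℓ i v) (hfin : (mulSupport c).Finite) (w : W) :
    Λ (π g w) = (∏ᶠ i, c i) * Λ w := by
  classical
  suffices hmaps : Λ ∘ₗ π g = (∏ᶠ i, c i) • Λ by
    simpa using LinearMap.congr_fun hmaps w
  refine hπ.isRestrictedTensorProduct.linearMap_ext fun x => ?_
  rw [LinearMap.comp_apply, LinearMap.smul_apply, ← hπ.map_smul g x, hΛ, hΛ, smul_eq_mul]
  -- the two finite products, factor by factor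
  set c' : ι → k := fun i => if i ∈ S₀ then 1 else c i with hc'
  have hF : ∀ i, RestrictedTensorProduct.retractionFactor S₀ ℓ (⇑(RestrictedFamily.smul ρ hx₀ g x)) i =
      c' i * RestrictedTensorProduct.retractionFactor S₀ ℓ (⇑x) i := by
    intro i
    simp only [RestrictedTensorProduct.retractionFactor, hc', RestrictedFamily.smul_apply]
    split_ifs
    · rw [one_mul]
    · exact hc i (x i)
  have hc'fin : (mulSupport c').Finite := hfin.subset fun i hi => by
    by_contra hci
    refine hi ?_
    simp only [hc']
    split_ifs
    · rfl
    · exact notMem_mulSupport.1 hci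
  have hS : ∏ i : S₀, ℓ i (RestrictedFamily.smul ρ hx₀ g x i) = (∏ i : S₀, c i) * ∏ i : S₀, ℓ i (x i) := by
    rw [← Finset.prod_mul_distrib]
    exact Finset.prod_congr rfl fun i _ => by rw [RestrictedFamily.smul_apply, hc]
  rw [finprod_congr hF, finprod_mul_distrib hc'fin
    (IsRestrictedTensorProduct.finite_mulSupport_retractionFactor ℓ hℓ x), hS,
    finprod_eq_prod_mul_finprod_ite c hfin S₀, ← Finset.prod_coe_sort S₀ c]
  ring

/-- **Twisted coinvariants of a restricted tensor product are non-zero (local ⇒ global).**  Let `H` act on the model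
`W` of `⊗'_i (V i, x₀ i)` through `φ : H →* Πʳ i, [G i, K i]` and the representation `⊗' ρ i`, and let `χ : H →* kˣ`.
Suppose there are local linear forms `ℓ i` that are `(φ h)_i`-EIGEN with eigenvalues `c h i` whose (finite) product is
`χ h`, normalised by `ℓ i (x₀ i) = 1` off `S₀` and taking the value `1` somewhere for `i ∈ S₀`.  Then the space of
`χ`-coinvariants `W ⧸ span {h · w − χ h • w}` (`TwistedCoinv.Coinv (π ∘ φ) χ`) is non-trivial: the product form is
`χ`-equivariant and non-zero, so it descends (`TwistedCoinv.lift`) to a non-zero linear form on the coinvariants.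
[cite: Flath1979, §2  Example 2] -/
theorem nontrivial_coinv_of_localEigenfunctionals [Nontrivial k] {H : Type uH} [Group H]
    (hπ : IsRestrictedTensorProductRep ρ π hx₀ j S₀) (φ : H →* Πʳ i, [G i, K i]) (χ : H →* kˣ)
    (ℓ : ∀ i, V i →ₗ[k] k) (hℓ : ∀ i ∉ S₀, ℓ i (x₀ i) = 1) (hℓ1 : ∀ i ∈ S₀, ∃ v : V i, ℓ i v = 1)
    (c : H → ι → k) (hc : ∀ (h : H) (i : ι) (v : V i), ℓ i (ρ i ((φ h) i) v) = c h i * ℓ i v)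
    (hfin : ∀ h : H, (mulSupport (c h)).Finite) (hχ : ∀ h : H, ((χ h : kˣ) : k) = ∏ᶠ i, c h i) :
    Nontrivial (Literature.RepresentationTheory.TwistedCoinv.Coinv (π.comp φ) χ) := by
  obtain ⟨Λ, hΛ⟩ := hπ.isRestrictedTensorProduct.exists_prodDual ℓ hℓ
  have hΛχ : ∀ (h : H) (w : W), Λ ((π.comp φ) h w) = ((χ h : kˣ) : k) • Λ w := fun h w => by
    rw [MonoidHom.comp_apply, prodDual_rep_apply hπ hℓ hΛ (φ h) (c h) (hc h) (hfin h) w, hχ h, smul_eq_mul]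
  have hL : Literature.RepresentationTheory.TwistedCoinv.lift (π.comp φ) χ Λ hΛχ ≠ 0 := by
    rw [Ne, Literature.RepresentationTheory.TwistedCoinv.lift_eq_zero_iff]
    exact IsRestrictedTensorProduct.prodDual_ne_zero hℓ hℓ1 hΛ
  by_contra hnt
  rw [not_nontrivial_iff_subsingleton] at hnt
  exact hL (LinearMap.ext fun x => by rw [Subsingleton.elim x 0, map_zero, LinearMap.zero_apply])

/-- **The same with the local input through submodules** (local «augmentations»).  Over a field: let `N i ≤ V i`
contain every `ρ i ((φ h) i) v − c h i • v` (so that forms killing `N i` are eigenforms), with `V i ⧸ N i ≠ 0` for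
`i ∈ S₀` (LOCAL NON-VANISHING of the `χ_i`-quotient) and `x₀ i ∉ N i` for `i ∉ S₀` (the base vector SURVIVES in the
local quotient — «unramified»); let `χ h = ∏_i c h i` (finite products).  Then the `χ`-coinvariants of the restricted
tensor product representation under `H` are non-trivial.  This is the passage «every local quotient
`ω(μ_v,ε_v,χ_v) ≠ 0` ⇒ the global `χ`-quotient `≠ 0`» for a model presenting the global object as coinvariants of
`⊗'_v` ([Liu2021] Def. 4.11 with App. D Lem. D.1 (1) as the local input). [cite: Flath1979, §2  Example 2] -/
theorem nontrivial_coinv_of_localQuotients {k : Type uk} [Field k] [∀ i, Module k (V i)] [Module k W]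
    {ρ : ∀ i, Representation k (G i) (V i)} {hx₀ : ∀ᶠ i in cofinite, x₀ i ∈ (ρ i).fixedPoints (K i)}
    {π : Representation k (Πʳ i, [G i, K i]) W} {j : RestrictedFamily V x₀ → W} {H : Type uH} [Group H]
    (hπ : IsRestrictedTensorProductRep ρ π hx₀ j S₀) (φ : H →* Πʳ i, [G i, K i]) (χ : H →* kˣ)
    (N : ∀ i, Submodule k (V i)) (c : H → ι → k)
    (hN : ∀ (h : H) (i : ι) (v : V i), ρ i ((φ h) i) v - c h i • v ∈ N i)
    (hS₀ : ∀ i ∈ S₀, N i ≠ ⊤) (hx₀N : ∀ i ∉ S₀, x₀ i ∉ N i)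
    (hfin : ∀ h : H, (mulSupport (c h)).Finite) (hχ : ∀ h : H, ((χ h : kˣ) : k) = ∏ᶠ i, c h i) :
    Nontrivial (Literature.RepresentationTheory.TwistedCoinv.Coinv (π.comp φ) χ) := by
  classical
  -- local forms: killing `N i`, normalised at `x₀ i` off `S₀`, with value `1` somewhere on `S₀`
  have hloc : ∀ i, ∃ ℓ : V i →ₗ[k] k, (∀ n ∈ N i, ℓ n = 0) ∧ (i ∉ S₀ → ℓ (x₀ i) = 1) ∧ ∃ v, ℓ v = 1 := by
    intro i
    by_cases hi : i ∈ S₀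
    · obtain ⟨ℓ, hℓN, v, hv⟩ := exists_dual_vanishing_of_ne_top (N i) (hS₀ i hi)
      exact ⟨ℓ, hℓN, fun h => (h hi).elim, v, hv⟩
    · obtain ⟨ℓ, hℓN, h1⟩ := exists_dual_vanishing_eq_one (N i) (hx₀N i hi)
      exact ⟨ℓ, hℓN, fun _ => h1, x₀ i, h1⟩
  choose ℓ hℓN hℓ1 hℓv using hloc
  refine nontrivial_coinv_of_localEigenfunctionals hπ φ χ ℓ hℓ1 (fun i _ => hℓv i) c
    (fun h i v => apply_eq_mul_of_forall_sub_smul (ℓ i) (ρ i ((φ h) i)) (c h i)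
      (fun v => hℓN i _ (hN h i v)) v) hfin hχ

end IsRestrictedTensorProductRep

/-! ### Non-vacuity of the hypothesis set (kernel certificate) -/

/-- **The hypotheses of `nontrivial_coinv_of_localQuotients` are jointly inhabited** (tribunal item T5, in the
kernel): for the ONE-FACTOR trivial product — index `PUnit`, groups `G := PUnit` with `K := ⊤`, `V := k` with base
vector `1`, `ρ := 1`, the tree's CONSTRUCTED model `(RestrictedTensorProduct k x₀, ⊗' ρ, ⊗')`
(`RestrictedTensorProduct.isRestrictedTensorProductRep`, exceptional set `∅`), `H := PUnit` acting through `φ := 1`,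
`χ := 1`, `N := ⊥`, `c := 1` — every hypothesis holds, and the conclusion is the non-triviality of the trivial
coinvariants of `k`.  A statement about hypothesis shapes; our bookkeeping. [cite: Flath1979, §2] -/
theorem nontrivial_coinv_of_localQuotients_inhabited (k : Type uk) [Field k] :
    ∃ (π : Representation k (Πʳ _ : PUnit.{u + 1}, [PUnit.{uG + 1}, (⊤ : Subgroup PUnit.{uG + 1})])
        (RestrictedTensorProduct k (fun _ : PUnit.{u + 1} => (1 : k))))
      (φ : PUnit.{uH + 1} →* Πʳ _ : PUnit.{u + 1}, [PUnit.{uG + 1}, (⊤ : Subgroup PUnit.{uG + 1})]),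
      Nontrivial (Literature.RepresentationTheory.TwistedCoinv.Coinv (π.comp φ) (1 : PUnit.{uH + 1} →* kˣ)) := by
  classical
  let ρ : ∀ _ : PUnit.{u + 1}, Representation k PUnit.{uG + 1} k := fun _ => 1
  have hx₀ : ∀ᶠ i in cofinite, (fun _ : PUnit.{u + 1} => (1 : k)) i ∈
      (ρ i).fixedPoints ((fun _ => (⊤ : Subgroup PUnit.{uG + 1})) i) :=
    Eventually.of_forall fun i => by simp [ρ]
  have hπ := RestrictedTensorProduct.isRestrictedTensorProductRep (K := fun _ => (⊤ : Subgroup PUnit.{uG + 1}))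
    (x₀ := fun _ : PUnit.{u + 1} => (1 : k)) ρ ∅ hx₀ (fun _ _ => one_ne_zero)
  refine ⟨RestrictedTensorProduct.rep ρ hx₀, 1, ?_⟩
  refine IsRestrictedTensorProductRep.nontrivial_coinv_of_localQuotients hπ 1 1 (fun _ => ⊥) (fun _ _ => 1)
    (fun h i v => ?_) (fun i hi => (Finset.notMem_empty i hi).elim) (fun i _ => ?_) (fun _ => ?_) (fun _ => ?_)
  · simp [ρ]
  · simp
  · simp
  · simp

end ProdDual

end Literature.NumberTheory.Automorphic

end
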